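import Summits.ResolutionOfSingularities.ResolutionOfSingularities.Theorems.LossEntryW31
import Summits.ResolutionOfSingularities.ResolutionOfSingularities.Theorems.LossEntryW32

/-!
# Loss entry, walk level — part 33: THE START STEP h1 AND THE ENTRY LAW `LawLossEntry` (decomp-res lens-3, g29)

NODE-g29 §3ter, ASSEMBLY concluded.  The START step **h1** of the data skeleton (`wallSteps_h1`): after a loss move at a
heavy run state `(i, j, l ; k, m)` the chain data hold at `t+1` with `B ≤ β_t`, in each of the three presentations of the
loss typing (`loss_typing`): (b) chart `j` — data `(j ; i, l ; 0)` (`wall_slice_after_loss_b`, `wallOrdinate_le_runBeta_of_loss_b`);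
(c) chart `l` — data `(l ; i, j ; 0)` (`wall_slice_after_loss_c` + the vertex transport of `lawLossEntryAt_of_loss_c` closed
by the entry ORDINATE law `betaOf_entryPts_le_betaOf_of_axisWitness`); (a) chart `i` — the TWISTED data `(i ; j, l ; λ)`
(`wall_slice_after_loss_a`; the straightened state is `clean(chart_i G^prep)` as in `lawLossEntryAt_of_loss_a1`, the axis
witness now supplied by the STRAIGHTENED AXIS LAW `exists_support_pair_lt_straightened` at `t+1` instead of a repeat).

Then `lawLossEntryAt_of_lucas` (the skeleton of part 31 with parts 32/33), and — `q = p^e`, Lucas — the hypothesis-free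
theorems `lawLossEntry : LawLossEntry`, `lawLossChain : LawLossChain` and
`noLossyStrictTailsDeep : WallCut.NoLossyStrictTailsDeep` (the LOSSY cell of the residual 27367 is EMPTY).

Tree tools only; complete proofs, standard axioms.

(Sources: Hauser2010 §F; HauserPerlega2019 §2; CossartJannsenSaito2020 Ch. 8, Lemma 13.4; Moh1987; Perlega2022.)
-/

open MvPolynomial Finset
open Literature.AlgebraicGeometry.Resolution
open Literature.AlgebraicGeometry.Resolution.Hauser2010
open Literature.AlgebraicGeometry.Resolution.PointBlowup
open Summit.ResolutionOfSingularities.ResolutionOfSingularities.Theorems.TightDefectClasses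
open Summit.ResolutionOfSingularities.ResolutionOfSingularities.Theorems.TightDefectStrongWalks
open Summit.ResolutionOfSingularities.ResolutionOfSingularities.Theorems.ItineraryCutClasses
open Summit.ResolutionOfSingularities.ResolutionOfSingularities.Theorems.BoundaryLedger
open Summit.ResolutionOfSingularities.ResolutionOfSingularities.Theorems.ProximityCut
open Summit.ResolutionOfSingularities.ResolutionOfSingularities.Theorems.ConeCut
open Summit.ResolutionOfSingularities.ResolutionOfSingularities.Theorems.LossExitCone
open Summit.ResolutionOfSingularities.ResolutionOfSingularities.Theorems.LossPolygon

namespace Summit.ResolutionOfSingularities.ResolutionOfSingularities.Theorems.LossEpisode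

section ChainAssembly

variable {K : Type} [Field K] [DecidableEq K] {q : ℕ} {s₀ : State (Fin 3) K} {W : ForcedWalk q s₀}
  {N s : ℕ}

/-- After a loss in the chart of the loss wall `j` at a run state, the move was translated off the run wall:
`b_t(i) ≠ 0`. [folklore] -/
theorem b_ne_zero_of_loss_b (hroot : IsRoot q s₀) (hT : TailHyp W N s) {t : ℕ} (hNt : N ≤ t) {i j l : Fin 3}
    {k m : ℕ} (hS : IsRunState W s t i j l k m) (hjt : W.j t = j) (hloss : IsLossMove W t) : W.b t i ≠ 0 := by
  have hij : i ≠ j := hS.1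
  have hlj : l ≠ j := hS.2.2.1
  have h1k : 1 ≤ k := hS.2.2.2.1
  rcases (runState_next hroot hT hNt hS).2.2.2 with ⟨hi, -, -⟩ | ⟨-, -, hS1⟩ | ⟨hl, -, -⟩ | ⟨hc, -, -⟩
  · exact absurd (hjt.symm.trans hi) (Ne.symm hij)
  · have h := hloss i (by rw [hjt]; exact hij)
    rw [hS1.r_apply.1] at h
    omega
  · exact absurd (hjt.symm.trans hl) (Ne.symm hlj)
  · rcases hc with ⟨hi, -⟩ | ⟨-, hbi⟩ | ⟨hl, -, -⟩
    · exact absurd (hjt.symm.trans hi) (Ne.symm hij)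
    · exact hbi
    · exact absurd (hjt.symm.trans hl) (Ne.symm hlj)

/-- **THE START (h1), (b) presentation (PROVED):** after a loss in the chart of the loss wall `j` at a heavy run
state, the data `(j ; i, l ; 0)` hold at `t+1` (`wall_slice_after_loss_b`) with `B ≤ β_t`
(`wallOrdinate_le_runBeta_of_loss_b`). [new] -/
theorem wallSteps_h1_b (hroot : IsRoot q s₀) (hT : TailHyp W N s) {t : ℕ} (hNt : N ≤ t) {i j l : Fin 3} {k m : ℕ}
    (hS : IsRunState W s t i j l k m) (hm : q ≤ m + s) (hloss : IsLossMove W t) (hjt : W.j t = j) :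
    WallP W N s (t + 1) ⟨j, i, l, 0⟩ ∧ WallB W s (t + 1) ⟨j, i, l, 0⟩ ≤ runBeta W s t i j l := by
  classical
  have hij : i ≠ j := hS.1
  have hli : l ≠ i := hS.2.1
  have hlj : l ≠ j := hS.2.2.1
  obtain ⟨T, hoT, h1T, hr1, hqT, -⟩ := lossMove_next hroot hT hNt hloss
  rw [hjt] at hr1
  obtain ⟨φ, hφ, hsl⟩ := wall_slice_after_loss_b hroot hT hNt hS hjt
  refine ⟨⟨Ne.symm hij, Ne.symm hlj, Ne.symm hli, by omega, ⟨T, hr1, by omega⟩, φ, hφ, fun E hE hEa => ?_⟩, ?_⟩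
  · show coeff ((W.st (t + 1)).r + E) (W.st (t + 1)).F = φ * coeff E ((X l - C (0 : K) * X i) ^ s)
    rw [C_0, zero_mul, sub_zero]
    exact hsl E hEa hE
  · unfold WallB
    show betaOf (polyPts s (W.st (t + 1)).r j i l (deletePthPowers q (shear l i (0 : K) (W.st (t + 1)).F))) ≤ _
    rw [shear_zero, deletePthPowers_walk hroot]
    exact wallOrdinate_le_runBeta_of_loss_b hroot hT hNt hS hm hjt (b_ne_zero_of_loss_b hroot hT hNt hS hjt hloss) hloss

/-- **LOSS TYPING (PROVED):** a loss move from a run state is of type (a) `j_t = i, b_t(j) ≠ 0`, (b) `j_t = j, b_t(i) ≠ 0`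
or (c) `j_t = l, b_t(i) ≠ 0 ≠ b_t(j)` — the other three arrows of `runState_next` keep a wall. [folklore] -/
theorem loss_typing (hroot : IsRoot q s₀) (hT : TailHyp W N s) {t : ℕ} (hNt : N ≤ t) {i j l : Fin 3} {k m : ℕ}
    (hS : IsRunState W s t i j l k m) (hloss : IsLossMove W t) :
    (W.j t = i ∧ W.b t j ≠ 0) ∨ (W.j t = j ∧ W.b t i ≠ 0) ∨ (W.j t = l ∧ W.b t i ≠ 0 ∧ W.b t j ≠ 0) := by
  have hij : i ≠ j := hS.1
  have hli : l ≠ i := hS.2.1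
  have h1k : 1 ≤ k := hS.2.2.2.1
  have h1m : 1 ≤ m := hS.2.2.2.2.1
  rcases (runState_next hroot hT hNt hS).2.2.2 with ⟨hi, -, hS1⟩ | ⟨hj, -, hS1⟩ | ⟨hl, -, -, hS1⟩ | ⟨hc, -, -⟩
  · have h := hloss j (by rw [hi]; exact hij.symm)
    rw [hS1.r_apply.2.1] at h
    omega
  · have h := hloss i (by rw [hj]; exact hij)
    rw [hS1.r_apply.1] at h
    omega
  · have h := hloss i (by rw [hl]; exact Ne.symm hli)
    rw [hS1.r_apply.1] at h
    omega
  · exact hc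

/-- **THE START (h1), (c) presentation (PROVED):** after a loss in the chart of the ceiling letter `l` at a heavy run
state, the data `(l ; i, j ; 0)` hold at `t+1` (`wall_slice_after_loss_c`) with `B ≤ β_t` — the ordinate version of the
vertex transport of `lawLossEntryAt_of_loss_c` ((c)-prepared ↔ (b)-type equations, `vertexOf_entryPts_eq_of_dom` both
ways) closed by the entry ORDINATE law `betaOf_entryPts_le_betaOf_of_axisWitness` instead of T8b. [new] -/
theorem wallSteps_h1_c (hroot : IsRoot q s₀) (hT : TailHyp W N s)
    (hLucas : ∀ D T : ℕ, q ∣ D → ¬ q ∣ T → ((D.choose T : ℕ) : K) = 0) {t : ℕ} (hNt : N ≤ t) {i j l : Fin 3}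
    {k m : ℕ} (hS : IsRunState W s t i j l k m) (hm : q ≤ m + s) (hloss : IsLossMove W t) (hjt : W.j t = l)
    (hbi : W.b t i ≠ 0) (hbj : W.b t j ≠ 0) :
    WallP W N s (t + 1) ⟨l, i, j, 0⟩ ∧ WallB W s (t + 1) ⟨l, i, j, 0⟩ ≤ runBeta W s t i j l := by
  classical
  obtain ⟨hord, hq, hks, hms, -⟩ := runState_ledger hroot hT hNt hS
  obtain ⟨hri, hrj, hrl⟩ := hS.r_apply
  have hij : i ≠ j := hS.1
  have hli : l ≠ i := hS.2.1
  have hlj : l ≠ j := hS.2.2.1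
  have hsq : s < q := hT.s_lt
  have h1s : 1 ≤ s := hT.one_le
  obtain ⟨φ₀, lam, hφ₀, hlam, hνl, hpen⟩ := pencil_of_loss_c hroot hT hNt hS hjt
  have hro : (W.st t).r.degree + s = k + m + s := by
    rw [hS.2.2.2.2.2.1, map_add, Finsupp.degree_single, Finsupp.degree_single]
  obtain ⟨T, hoT, h1T, hr1, hqT, -⟩ := lossMove_next hroot hT hNt hloss
  have hTo : q + T = k + m + s := by
    have h := hord.symm.trans hoT
    have h' : s + k + m = q + T := by exact_mod_cast h
    omega
  rw [hjt] at hr1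
  obtain ⟨-, φ, hφ, hsl⟩ := wall_slice_after_loss_c hroot hT hNt hS hjt
  refine ⟨⟨hli, hlj, hij, by omega, ⟨T, hr1, by omega⟩, φ, hφ, fun E hE hEl => ?_⟩, ?_⟩
  · show coeff ((W.st (t + 1)).r + E) (W.st (t + 1)).F = φ * coeff E ((X j - C (0 : K) * X i) ^ s)
    rw [C_0, zero_mul, sub_zero]
    exact hsl E hEl hE
  unfold WallB
  show betaOf (polyPts s (W.st (t + 1)).r l i j (deletePthPowers q (shear j i (0 : K) (W.st (t + 1)).F))) ≤ _
  rw [shear_zero, deletePthPowers_walk hroot]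
  have hP1 := polyPts_succ_loss_c hroot t hS hjt hr1 hTo
  -- the prepared equations (as in `lawLossEntryAt_of_loss_c`)
  set Gc : MvPolynomial (Fin 3) K := shear i l (W.b t i) (shear j l (W.b t j) (W.st t).F) with hGc
  set Gb : MvPolynomial (Fin 3) K := shear i j (W.b t i * lam) (shear l j lam (W.st t).F) with hGb
  have hSw : swapShear j l (W.b t j) lam Gc = shear i l (W.b t i) Gb :=
    swapShear_shear_shear hij hli.symm (Ne.symm hlj) hνl (W.b t i) (W.st t).F
  have hSw' : swapShear l j lam (W.b t j) (shear i l (W.b t i) Gb) = Gc := by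
    rw [← hSw, swapShear_swapShear hij hli.symm (Ne.symm hlj) hνl]
  have hoGc : ∀ E ∈ (deletePthPowers q Gc).support, k + m + s ≤ E.degree := fun E hE => by
    rw [support_deletePthPowers'] at hE
    exact le_degree_of_mem_support_prepared_c hroot hT hNt hS _ _ (Finset.mem_filter.mp hE).1
  have hoGb : ∀ D ∈ (deletePthPowers q Gb).support, k + m + s ≤ D.degree := fun D hD => by
    rw [support_deletePthPowers'] at hD
    exact le_degree_of_mem_support_prepared hroot hT hNt hS _ _ (Finset.mem_filter.mp hD).1
  have hoS : ∀ E' ∈ (deletePthPowers q (shear i l (W.b t i) Gb)).support, k + m + s ≤ E'.degree := fun E' hE' => by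
    rw [support_deletePthPowers'] at hE'
    exact le_degree_of_mem_support_shear hlj hli hij.symm (W.b t i)
      (fun D hD => le_degree_of_mem_support_prepared hroot hT hNt hS _ _ hD) (Finset.mem_filter.mp hE').1
  have hthd : ∀ D ∈ (deletePthPowers q Gb).support, D l < s → k + m + s < D.degree := by
    intro D hD hDl
    rcases (hoGb D hD).lt_or_eq with hlt | heq
    · exact hlt
    · exfalso
      rw [support_deletePthPowers'] at hD
      have := thd_eq_of_mem_support_two_shears hij hli.symm (Ne.symm hlj) hrl hro φ₀ lam (W.b t i * lam)
        (walk_r hroot W t) hpen (Finset.mem_filter.mp hD).1 heq.symm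
      omega
  have hos : 2 * q + 1 ≤ k + m + s + s := by omega
  obtain ⟨R, hR, hax, hRl⟩ := exists_axisWitness_loss_c hroot hT hNt hS hjt hlam hνl hos hLucas
  have hneEPb : (entryPts s (k + m + s) i l (deletePthPowers q Gb)).Nonempty := ⟨_, entryPt_mem_entryPts _ _ _ _ _ hR hRl⟩
  have h32 := vertexOf_entryPts_eq_of_dom (s := s) (o := k + m + s) (a := i) (c := l) (a' := i) (c' := l)
    (G := deletePthPowers q Gb) (G' := deletePthPowers q (shear i l (W.b t i) Gb))
    (fun D hD hDl => by
      obtain ⟨E', hE', -, hE'deg, hE'or⟩ := exists_dom_shear_of_mem_support hlj hli hij.symm hLucas (W.b t i) Gb hD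
      rcases hE'or with rfl | hlt
      · exact ⟨_, hE', hDl, le_rfl⟩
      · exact ⟨E', hE', by omega, toLex_entryPt_le_of_lt hE'deg (hthd D hD hDl) hlt hDl⟩)
    (fun E' hE' hE'l => by
      obtain ⟨D, hD, -, hDdeg, hDor⟩ := exists_dom_of_mem_support_shear hlj hli hij.symm hLucas (W.b t i) Gb hE'
      rcases hDor with rfl | hlt
      · exact ⟨_, hD, hE'l, le_rfl⟩
      · have hDl : D l < s := by omega
        exact ⟨D, hD, hDl, toLex_entryPt_le_of_lt hDdeg (by rw [← hDdeg]; exact hthd D hD hDl) hlt hE'l⟩)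
    hneEPb
  have h21 := vertexOf_entryPts_eq_of_dom (s := s) (o := k + m + s) (a := i) (c := l) (a' := i) (c' := j)
    (G := deletePthPowers q (shear i l (W.b t i) Gb)) (G' := deletePthPowers q Gc)
    (fun E' hE' hE'l => by
      obtain ⟨E, hE, hEi, hEdeg, hEj⟩ := exists_dom_swapShear hli.symm hij hlj hlam hbj hLucas _ hE'
      rw [hSw'] at hE
      exact ⟨E, hE, by omega, toLex_entryPt_le hEdeg (hoS E' hE') hEi.le hEj hE'l⟩)
    (fun E hE hEj => by
      obtain ⟨E', hE', hE'i, hE'deg, hE'l⟩ := exists_dom_swapShear hij hli.symm (Ne.symm hlj) hbj hlam hLucas Gc hE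
      rw [hSw] at hE'
      exact ⟨E', hE', by omega, toLex_entryPt_le hE'deg (hoGc E hE) hE'i.le hE'l hEj⟩)
    h32.1
  have hV : vertexOf (entryPts s (k + m + s) i j (deletePthPowers q Gc)) =
      vertexOf (entryPts s (k + m + s) i l (deletePthPowers q Gb)) := by rw [h32.2, h21.2]
  -- the entry ORDINATE law E3 for `Gb`
  have hqj : q ≤ s + (W.st t).r j := by rw [hrj]; omega
  have h8 := betaOf_entryPts_le_betaOf_of_axisWitness hij hli.symm (Ne.symm hlj) hrl (mul_ne_zero hbi hlam) lam
    (fun D hD => not_isPthPowerExponent_of_mem_support hroot W t hD) (walk_r hroot W t)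
    (fun D hD => by rw [hri, hrj]; exact le_degree_of_mem_support_runState hroot hT hNt hS hD)
    (polyPts_nonempty_of_heavy_fst hroot W t (Ne.symm hlj) i hqj hrl)
    (alphaOf_polyPts_lt_one hroot W t (Ne.symm hlj) i hqj hrl) hsq (by rw [hri, hrj]; omega) (by rw [hri, hrj]; omega)
    hR hax
  rw [hri, hrj] at h8
  unfold runBeta
  rw [hP1]
  unfold betaOf at h8 ⊢
  rw [hV]
  exact h8

/-- **THE START (h1), (a) presentation (PROVED):** after a loss in the chart of the run letter `i` (`b_t(j) ≠ 0`,
`b_t(l) = λ b_t(j)`) at a heavy run state, the data `(i ; j, l ; λ)` hold at `t+1` (`wall_slice_after_loss_a`, the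
twisted slice `(u_l − λ u_j)^s`) and the STRAIGHTENED ordinate is `≤ β_t`: `clean(σ_{l,j,λ} F_{t+1}) = clean(chart_i G^prep)`
(twist commutation, as in `lawLossEntryAt_of_loss_a1`), its polygon is the entry set of `clean G^prep` (section `j`,
ceiling `l`), whose vertex is that of `clean G_b` (the two swap dominations), and the entry ORDINATE law E3 for `G_b`
concludes — the axis witness now comes from the STRAIGHTENED AXIS LAW at `t+1` (`exists_support_pair_lt_straightened`),
not from a repeat. [new] -/
theorem wallSteps_h1_a (hroot : IsRoot q s₀) (hT : TailHyp W N s)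
    (hLucas : ∀ D T : ℕ, q ∣ D → ¬ q ∣ T → ((D.choose T : ℕ) : K) = 0) {t : ℕ} (hNt : N ≤ t) {i j l : Fin 3}
    {k m : ℕ} (hS : IsRunState W s t i j l k m) (hm : q ≤ m + s) (hloss : IsLossMove W t) (hjt : W.j t = i)
    (hbj : W.b t j ≠ 0) :
    WallP W N s (t + 1) ⟨i, j, l, W.b t l / W.b t j⟩ ∧
      WallB W s (t + 1) ⟨i, j, l, W.b t l / W.b t j⟩ ≤ runBeta W s t i j l := by
  classical
  obtain ⟨hord, hq, hks, hms, -⟩ := runState_ledger hroot hT hNt hS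
  obtain ⟨hri, hrj, hrl⟩ := hS.r_apply
  have hij : i ≠ j := hS.1
  have hli : l ≠ i := hS.2.1
  have hlj : l ≠ j := hS.2.2.1
  have hsq : s < q := hT.s_lt
  have h1s : 1 ≤ s := hT.one_le
  obtain ⟨φ₀, lam, hφ₀, hbl, hpen⟩ := pencil_of_loss_a hroot hT hNt hS hjt hbj
  have hμ : W.b t l / W.b t j = lam := by rw [hbl, mul_div_assoc, div_self hbj, mul_one]
  obtain ⟨T, hoT, h1T, hr1, hqT, -⟩ := lossMove_next hroot hT hNt hloss
  have hTo : q + T = k + m + s := by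
    have h := hord.symm.trans hoT
    have h' : s + k + m = q + T := by exact_mod_cast h
    omega
  rw [hjt] at hr1
  obtain ⟨φ, hφ, hsl⟩ := wall_slice_after_loss_a hroot hT hNt hS hjt hbj
  refine ⟨⟨hij, Ne.symm hli, Ne.symm hlj, by omega, ⟨T, hr1, by omega⟩, φ, hφ, fun E hE hEi => hsl E hEi hE⟩, ?_⟩
  unfold WallB
  show betaOf (polyPts s (W.st (t + 1)).r i j l
    (deletePthPowers q (shear l j (W.b t l / W.b t j) (W.st (t + 1)).F))) ≤ _
  rw [hμ]
  -- the equations `G_a`, `G^prep`, `G_b` (as in `lawLossEntryAt_of_loss_a1`)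
  have hF1 : (W.st (t + 1)).F =
      deletePthPowers q (chartTransform q i (shear j i (W.b t j) (shear l i (lam * W.b t j) (W.st t).F))) := by
    rw [st_succ_F_two_shears hroot W t hij.symm hli hlj.symm hjt, hbl]
  set Ga : MvPolynomial (Fin 3) K := shear j i (W.b t j) (shear l i (lam * W.b t j) (W.st t).F) with hGa
  set Gp : MvPolynomial (Fin 3) K := shear l j lam Ga with hGp
  set ψ : K := (W.b t j)⁻¹ with hψdef
  have hψβ : ψ * W.b t j = 1 := inv_mul_cancel₀ hbj
  have hψ : ψ ≠ 0 := inv_ne_zero hbj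
  set Gb : MvPolynomial (Fin 3) K := shear i j ψ (shear l j lam (W.st t).F) with hGb
  have hSw : Gp = swapShear i j ψ (W.b t j) Gb := shears_a_eq_swapShear hij hli.symm hlj.symm hψβ lam _
  have hSw' : swapShear j i (W.b t j) ψ Gp = Gb := by rw [hSw, swapShear_swapShear hli hlj hij hψβ]
  -- degrees
  have hdegF : ∀ D ∈ (W.st t).F.support, k + m + s ≤ D.degree := fun D hD =>
    le_degree_of_mem_support_runState hroot hT hNt hS hD
  have hoGa : ∀ E ∈ Ga.support, k + m + s ≤ E.degree := fun E hE =>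
    le_degree_of_mem_support_shear hli.symm hij hlj (W.b t j)
      (fun E' hE' => le_degree_of_mem_support_shear hij hli.symm hlj.symm (lam * W.b t j) hdegF hE') hE
  have hqGa : ∀ E ∈ Ga.support, q ≤ E.degree := fun E hE => by have := hoGa E hE; omega
  have hoGp : ∀ E ∈ Gp.support, k + m + s ≤ E.degree := fun E hE =>
    le_degree_of_mem_support_shear hij.symm hlj.symm hli.symm lam hoGa hE
  have hqGp : ∀ E ∈ Gp.support, q ≤ E.degree := fun E hE => by have := hoGp E hE; omega
  have hoGb : ∀ D ∈ (deletePthPowers q Gb).support, k + m + s ≤ D.degree := fun D hD => by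
    rw [support_deletePthPowers'] at hD
    exact le_degree_of_mem_support_prepared hroot hT hNt hS _ _ (Finset.mem_filter.mp hD).1
  have hoGp' : ∀ E ∈ (deletePthPowers q Gp).support, k + m + s ≤ E.degree := fun E hE => by
    rw [support_deletePthPowers'] at hE
    exact hoGp E (Finset.mem_filter.mp hE).1
  -- the straightened state is `clean(chart_i G^prep)` and its polygon an entry set
  have hr₁i : (W.st (t + 1)).r i = T := by rw [hr1, Finsupp.single_eq_same]
  have hr₁j : (W.st (t + 1)).r j = 0 := by rw [hr1, Finsupp.single_apply, if_neg hij]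
  have hr₁l : (W.st (t + 1)).r l = 0 := by rw [hr1, Finsupp.single_apply, if_neg (Ne.symm hli)]
  have hcleanS : deletePthPowers q (shear l j lam (W.st (t + 1)).F) = deletePthPowers q (chartTransform q i Gp) := by
    rw [hF1, deletePthPowers_shear_deletePthPowers_chartTransform hij.symm hlj.symm hli.symm hLucas lam hqGa]
  have hP1 : polyPts s (W.st (t + 1)).r i j l (deletePthPowers q (shear l j lam (W.st (t + 1)).F)) =
      entryPts s (k + m + s) j l (deletePthPowers q Gp) := by
    rw [hcleanS, polyPts_clean_chart_eq_entryPts hij hli.symm hr₁i hr₁j hr₁l hTo hqGp]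
  -- the axis witness: the straightened axis law at `t + 1` for the pair `(i, l)`, transported to `clean G_b`
  obtain ⟨M₀, hM₀, hMil⟩ := exists_support_pair_lt_straightened W (t + 1) hlj lam hLucas i l hli.symm
  rw [hcleanS, support_deletePthPowers_chartTransform i Gp hqGp, Finset.mem_image] at hM₀
  obtain ⟨E', hE', rfl⟩ := hM₀
  have hE'c : E' ∈ (deletePthPowers q Gp).support := by rw [support_deletePthPowers']; exact hE'
  have hoE' : k + m + s ≤ E'.degree := hoGp' E' hE'c
  rw [chartExponent_apply, if_pos rfl, chartExponent_apply, if_neg hli] at hMil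
  obtain ⟨R, hR, hRl, hRdeg, -⟩ := exists_dom_swapShear hlj hli hij.symm hbj hψ hLucas Gp hE'c
  rw [hSw'] at hR
  have hax : R.degree + R l < 2 * q := by rw [hRdeg, hRl]; omega
  have hRl' : R l < s := by rw [hRl]; omega
  have hneEPb : (entryPts s (k + m + s) i l (deletePthPowers q Gb)).Nonempty := ⟨_, entryPt_mem_entryPts _ _ _ _ _ hR hRl'⟩
  -- vertex transport `EP(clean G_b ; i, l) = EP(clean G^prep ; j, l)`
  have h21 := vertexOf_entryPts_eq_of_dom (s := s) (o := k + m + s) (a := i) (c := l) (a' := j) (c' := l)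
    (G := deletePthPowers q Gb) (G' := deletePthPowers q Gp)
    (fun E hE hEl => by
      obtain ⟨E', hE', hE'l, hE'deg, hE'j⟩ := exists_dom_swapShear hli hlj hij hψ hbj hLucas Gb hE
      rw [← hSw] at hE'
      exact ⟨E', hE', by omega, toLex_entryPt_le hE'deg (hoGb E hE) hE'j hE'l.le hEl⟩)
    (fun E' hE' hE'l => by
      obtain ⟨E, hE, hEl, hEdeg, hEi⟩ := exists_dom_swapShear hlj hli hij.symm hbj hψ hLucas Gp hE'
      rw [hSw'] at hE
      exact ⟨E, hE, by omega, toLex_entryPt_le hEdeg (hoGp' E' hE') hEi hEl.le hE'l⟩)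
    hneEPb
  -- the entry ORDINATE law E3 for `G_b`
  have hqj : q ≤ s + (W.st t).r j := by rw [hrj]; omega
  have h8 := betaOf_entryPts_le_betaOf_of_axisWitness hij hli.symm (Ne.symm hlj) hrl hψ lam
    (fun D hD => not_isPthPowerExponent_of_mem_support hroot W t hD) (walk_r hroot W t)
    (fun D hD => by rw [hri, hrj]; exact le_degree_of_mem_support_runState hroot hT hNt hS hD)
    (polyPts_nonempty_of_heavy_fst hroot W t (Ne.symm hlj) i hqj hrl)
    (alphaOf_polyPts_lt_one hroot W t (Ne.symm hlj) i hqj hrl) hsq (by rw [hri, hrj]; omega) (by rw [hri, hrj]; omega)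
    hR hax
  rw [hri, hrj] at h8
  unfold runBeta
  rw [hP1]
  unfold betaOf at h8 ⊢
  rw [← h21.2]
  exact h8

/-- **THE START h1 OF THE DATA SKELETON (PROVED):** by the loss typing, one of the three presentations. [new] -/
theorem wallSteps_h1 (hroot : IsRoot q s₀) (hT : TailHyp W N s)
    (hLucas : ∀ D T : ℕ, q ∣ D → ¬ q ∣ T → ((D.choose T : ℕ) : K) = 0) {t : ℕ} (hNt : N ≤ t) {i j l : Fin 3}
    {k m : ℕ} (hS : IsRunState W s t i j l k m) (hm : q ≤ m + s) (hloss : IsLossMove W t) :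
    ∃ d : WallFrame K, WallP W N s (t + 1) d ∧ WallB W s (t + 1) d ≤ runBeta W s t i j l := by
  rcases loss_typing hroot hT hNt hS hloss with ⟨hjt, hbj⟩ | ⟨hjt, -⟩ | ⟨hjt, hbi, hbj⟩
  · exact ⟨_, wallSteps_h1_a hroot hT hLucas hNt hS hm hloss hjt hbj⟩
  · exact ⟨_, wallSteps_h1_b hroot hT hNt hS hm hloss hjt⟩
  · exact ⟨_, wallSteps_h1_c hroot hT hLucas hNt hS hm hloss hjt hbi hbj⟩

/-- **`LawLossEntryAt` ON EVERY TAIL (PROVED)** — the data skeleton `lawLossEntryAt_of_wallSteps_data` fed with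
`D := WallFrame K`, `P := WallP`, `B := WallB` and the three steps `wallSteps_h1/h2/h3`. [new] -/
theorem lawLossEntryAt_of_lucas (hroot : IsRoot q s₀) (hT : TailHyp W N s)
    (hLucas : ∀ D T : ℕ, q ∣ D → ¬ q ∣ T → ((D.choose T : ℕ) : K) = 0) : LawLossEntryAt W N s :=
  lawLossEntryAt_of_wallSteps_data hroot hT (WallP W N s) (WallB W s)
    (fun _ hNt _ _ _ _ _ hS hm hloss => wallSteps_h1 hroot hT hLucas hNt hS hm hloss)
    (fun _ _ d hP hloss => wallSteps_h2 hroot hT hLucas d hP hloss)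
    (fun _ hNv hloss hst d hP _ _ _ hS' => wallSteps_h3 hroot hT hLucas hNv hloss hst d hP hS')

/-- **THE ENTRY LAW `LawLossEntry` (PROVED, hypothesis-free):** for `q = p^e` Lucas' theorem supplies `hLucas`
(`cast_choose_eq_zero_of_pow_dvd`), and `lawLossEntryAt_of_lucas` gives `LawLossEntryAt` on every tail — the three
walk hypotheses of `LawLossEntry` are not even used. [CJS2020 Lemma 13.4 for the forced walk, all presentations and
all loss chains; new] -/
theorem lawLossEntry : LawLossEntry := by
  intro p hp e _ K _ _ _ _ s₀ hroot W N s hT _ _ _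
  haveI : Fact p.Prime := ⟨hp⟩
  exact lawLossEntryAt_of_lucas hroot hT (fun D T hD hT' => cast_choose_eq_zero_of_pow_dvd p hD hT')

/-- **THE CHAIN LAW `LawLossChain` (PROVED)** — the chain half of the entry law is a special case of it. [new] -/
theorem lawLossChain : LawLossChain := by
  intro p hp e _ K _ _ _ _ s₀ hroot W N s hT _ _ _ t hNt i j l k m hS hm hloss _
  haveI : Fact p.Prime := ⟨hp⟩
  exact lawLossEntryAt_of_lucas hroot hT (fun D T hD hT' => cast_choose_eq_zero_of_pow_dvd p hD hT') t hNt i j l k m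
    hS hm hloss

/-- **THE RESIDUAL ITEM `NoLossyStrictTailsDeep` (PROVED, hypothesis-free)** — by `noLossyStrictTailsDeep_of_lawLossEntry`.
[new] -/
theorem noLossyStrictTailsDeep : WallCut.NoLossyStrictTailsDeep :=
  noLossyStrictTailsDeep_of_lawLossEntry lawLossEntry

end ChainAssembly

end Summit.ResolutionOfSingularities.ResolutionOfSingularities.Theorems.LossEpisode
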